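import Mathlib
import HarnessLib

/-!
# The falling-factorial family `P_T^{(q)} = Σ_j e_j(g) X(X-1)⋯(X-j+1)/(q)_j` satisfies the Λ-recursion

Support file for the Sahi / Conjecture-P programme of route `PercNearOneGluingNoHeavy`
(`--supports stmt-CriticalPhenomena-4575`, prover prim-l12-p5 gen 48; proof note
`prim-l12-p5/PROOF-DIFFERENCE-HURWITZ-g48.md` §1 (Λ-rec)).  No definitions, no named facts, no sorries.

With `e T j = e_j(g_0,…,g_{T-1})` (elementary symmetric functions, given through their Pascal-type recursion
`e_{T+1,j+1} = e_{T,j+1} + g_T e_{T,j}`) and `(q)_j = q(q+1)⋯(q+j-1)`, the polynomials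
`P T q = Σ_{j ≤ T} C(e T j/(q)_j) · descPochhammer ℝ j` satisfy `P 0 q = 1` and, for `q > 0`,
`C q · P (T+1) q = (C q + X) · P T (q+1) - C (1 - g T) · (X · (P T (q+1)).comp (X - C 1))`
(`FallingMesh.closedForm_rec`) — the hypotheses of `FallingMesh.fallingMesh_roots_pos` (THEOREM Λ).  The two
operator facts used are `X·D_j(X-1) = D_{j+1}` and `X·D_j = j·D_j + D_{j+1}` for `D_j = descPochhammer ℝ j`.
-/

namespace Summit.CriticalPhenomena.PercolationContinuityZ3.Theorems

namespace FallingMesh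

open Finset Polynomial

/-- `X · D_j = j · D_j + D_{j+1}` for the falling factorials `D_j = descPochhammer ℝ j`. -/
theorem X_mul_descPochhammer (j : ℕ) :
    (X : ℝ[X]) * descPochhammer ℝ j = C (j : ℝ) * descPochhammer ℝ j + descPochhammer ℝ (j + 1) := by
  rcases j with _ | n
  · simp [descPochhammer_zero, descPochhammer_one]
  · have h1 := descPochhammer_succ_comp_X_sub_one ℝ n
    have h2 : descPochhammer ℝ (n + 1 + 1) = X * (descPochhammer ℝ (n + 1)).comp (X - 1) :=
      descPochhammer_succ_left ℝ (n + 1)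
    have h3 : descPochhammer ℝ (n + 1) = X * (descPochhammer ℝ n).comp (X - 1) :=
      descPochhammer_succ_left ℝ n
    rw [h2, h1, smul_eq_mul, mul_sub, ← mul_assoc, mul_comm X (↑n + 1 : ℝ[X]), mul_assoc, ← h3]
    have : (C ((n + 1 : ℕ) : ℝ) : ℝ[X]) = (n : ℝ[X]) + 1 := by
      rw [← map_natCast C, Nat.cast_succ]; simp
    rw [this]; ring

/-- **The closed form satisfies the Λ-recursion.** -/
theorem closedForm_rec (g : ℕ → ℝ) (e : ℕ → ℕ → ℝ) (he00 : e 0 0 = 1) (he0s : ∀ j, e 0 (j + 1) = 0)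
    (hes0 : ∀ t, e (t + 1) 0 = e t 0) (hess : ∀ t j, e (t + 1) (j + 1) = e t (j + 1) + g t * e t j)
    (P : ℕ → ℝ → ℝ[X])
    (hP : ∀ t q, P t q = ∑ j ∈ range (t + 1),
      C (e t j / ∏ i ∈ range j, (q + (i : ℝ))) * descPochhammer ℝ j) :
    (∀ q, P 0 q = 1) ∧ (∀ t q, 0 < q → C q * P (t + 1) q =
      (C q + X) * P t (q + 1) - C (1 - g t) * (X * (P t (q + 1)).comp (X - C 1))) := by
  -- e t j = 0 for j > t
  have hez : ∀ t j, t < j → e t j = 0 := by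
    intro t
    induction t with
    | zero => intro j hj; obtain ⟨j', rfl⟩ : ∃ j', j = j' + 1 := ⟨j - 1, by omega⟩; exact he0s j'
    | succ t ih =>
      intro j hj
      obtain ⟨j', rfl⟩ : ∃ j', j = j' + 1 := ⟨j - 1, by omega⟩
      rw [hess, ih (j' + 1) (by omega), ih j' (by omega), mul_zero, add_zero]
  refine ⟨fun q => ?_, fun t q hq => ?_⟩
  · rw [hP, sum_range_one, prod_range_zero, he00, div_one, C_1, descPochhammer_zero, mul_one]
  -- notation
  set D : ℕ → ℝ[X] := fun j => descPochhammer ℝ j with hD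
  have hDs : ∀ j, (X : ℝ[X]) * (D j).comp (X - C 1) = D (j + 1) := by
    intro j; simp only [hD]; rw [C_1, ← descPochhammer_succ_left]
  have hDX : ∀ j, (X : ℝ[X]) * D j = C (j : ℝ) * D j + D (j + 1) := fun j => X_mul_descPochhammer j
  -- Pochhammer products
  have hπpos : ∀ (q' : ℝ) (j : ℕ), 0 < q' → 0 < ∏ i ∈ range j, (q' + (i : ℝ)) :=
    fun q' j hq' => prod_pos fun i _ => by positivity
  have hπ1 : ∀ j, ∏ i ∈ range (j + 1), (q + (i : ℝ)) = q * ∏ i ∈ range j, (q + 1 + (i : ℝ)) := by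
    intro j
    rw [prod_range_succ', Nat.cast_zero, add_zero, mul_comm]
    congr 1
    exact prod_congr rfl fun i _ => by push_cast; ring
  have hπ2 : ∀ j, ∏ i ∈ range (j + 1), (q + 1 + (i : ℝ)) = (∏ i ∈ range j, (q + 1 + (i : ℝ))) * (q + 1 + j) := by
    intro j; rw [prod_range_succ]
  -- the coefficients
  set a : ℕ → ℝ := fun j => e t j / ∏ i ∈ range j, (q + 1 + (i : ℝ)) with ha
  -- RHS in normal form
  have hRHS : (C q + X) * P t (q + 1) - C (1 - g t) * (X * (P t (q + 1)).comp (X - C 1)) =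
      ∑ j ∈ range (t + 1), (C (a j * (q + j)) * D j + C (a j * g t) * D (j + 1)) := by
    rw [hP, mul_sum, Polynomial.sum_comp, mul_sum, mul_sum, ← sum_sub_distrib]
    refine sum_congr rfl fun j _ => ?_
    rw [C_mul_comp, ← mul_assoc X, mul_comm X (C _), mul_assoc (C _) X, hDs j, add_mul, mul_comm X,
      mul_assoc (C _) (D j) X, mul_comm (D j) X, hDX j]
    simp only [map_mul, map_add, map_sub, C_1, ha]
    ring
  -- LHS in normal form
  have hLHS : C q * P (t + 1) q = ∑ j ∈ range (t + 1 + 1),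
      C (q * e (t + 1) j / ∏ i ∈ range j, (q + (i : ℝ))) * D j := by
    rw [hP, mul_sum]
    refine sum_congr rfl fun j _ => ?_
    rw [← mul_assoc, ← C_mul, mul_div_assoc]
  rw [hRHS, hLHS, sum_range_succ' _ (t + 1), sum_add_distrib]
  -- split the first RHS sum: j = 0 term + shifted rest (the j = t+1 term vanishes since e t (t+1) = 0)
  have hat1 : a (t + 1) = 0 := by
    show e t (t + 1) / _ = 0
    rw [hez t (t + 1) (by omega), zero_div]
  have hsplit : ∑ j ∈ range (t + 1), C (a j * (q + j)) * D j =
      (∑ j ∈ range (t + 1), C (a (j + 1) * (q + (j + 1 : ℕ))) * D (j + 1)) + C (a 0 * (q + (0 : ℕ))) * D 0 := by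
    have h1 : ∑ j ∈ range (t + 1 + 1), C (a j * (q + j)) * D j = ∑ j ∈ range (t + 1), C (a j * (q + j)) * D j := by
      rw [sum_range_succ, hat1, zero_mul, C_0, zero_mul, add_zero]
    rw [← h1, sum_range_succ']
  rw [hsplit, add_assoc, add_comm (C (a 0 * _) * D 0), ← add_assoc, ← sum_add_distrib]
  congr 1
  · refine sum_congr rfl fun j _ => ?_
    rw [← add_mul, ← C_add]
    congr 2
    -- coefficient identity: q e(t+1)(j+1)/π(q,j+1) = a(j+1)(q+j+1) + a j g
    rw [ha]; simp only
    rw [hess, hπ1 j, hπ2 j]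
    have h1 : (∏ i ∈ range j, (q + 1 + (i : ℝ))) ≠ 0 := ne_of_gt (hπpos (q + 1) j (by linarith))
    have h2 : (q + 1 + (j : ℝ)) ≠ 0 := ne_of_gt (by positivity)
    have hq0 : q ≠ 0 := ne_of_gt hq
    field_simp
    push_cast
    ring
  · simp only [ha, hes0, prod_range_zero, div_one, Nat.cast_zero, add_zero]
    congr 2; ring

end FallingMesh

end Summit.CriticalPhenomena.PercolationContinuityZ3.Theorems
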